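import Summits.CriticalPhenomena.CardyFormulaZ2.Theorems.CardyFlipRussoJitteredTriangularLegApprox
import Literature.Probability.Percolation.CardyFormulaConformalInvariance

/-!
# `JitteredTriangularLeg` at `σ = 0`: Cardy's formula for the continuum hexagon crossing

Helper file for the support item `JitteredTriangularLeg` (stmt-CriticalPhenomena-6436) of route
`CardyFlipRusso`, concluding the `σ = 0` slice: the conclusion of the item at `σ = 0` — Cardy's
formula for the continuum crossing of `closure Ω` by the closed hexagons of the open sites of fair
site percolation on `𝕋` (the Benjamini–Schramm / Bollobás–Riordan Ch. 8 continuum event, instead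
of G02's `triCrossing`) — `jitteredTriangularLeg_sigma_zero`, with standard axioms.  The proof
re-runs the last layers of the tree's proof of Smirnov's theorem (Bollobás–Riordan, *Percolation*
(2006), Ch. 7, Thm. 2, pp. 196–203) with the continuum crossing probability in the sandwich:

* `contProb_conj` — reflection symmetry (`voronoiCrossing_conjSet_iff`, lattice reflection
  `triConj`, `sitePercolation_real_preimage_relabel`), for the clockwise Carleson data;
* `cont_separatingData_of_anticlockwise`, `cont_separatingData`, `cont_separatingFamilies` —
  copies of `smirnov_separatingData_of_discreteApprox`,
  `smirnov_exists_separatingData_of_anticlockwise`,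
  `smirnov_exists_separatingFamilies_of_separatingData` (the discrete facts Lemma 13, Claims 10,
  22, 23, Lemma 12, (40) being theorems of the tree);
* `tendsto_contProb_carlesonRatio` (Carleson form, via `IsSmirnovFamily.tendsto_apply_one` with
  (M), (U) proved) and `hasCrossingLimit_contProb` (via (B), (C) proved);
* `jitteredTriangularLeg_sigma_zero` — the item's conclusion at `σ = 0`, by
  `hasCrossingLimit_jitteredLeg_zero_iff`.

## References

* B. Bollobás, O. Riordan, *Percolation*, Cambridge University Press (2006), Ch. 7 Thm. 2
  p. 165, §7.2.6 pp. 196–203, remark p. 195; Ch. 8 §8.1–8.2.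
* S. Smirnov, *Critical percolation in the plane*, C. R. Acad. Sci. Paris 333 (2001), Thm. 1.
* I. Benjamini, O. Schramm, *Conformal invariance of Voronoi percolation*, CMP 197 (1998), §1.
-/

noncomputable section

open MeasureTheory Set Metric
open scoped Pointwise

namespace Summit.CriticalPhenomena.CardyFormulaZ2.Theorems

open Literature.Probability.Percolation Literature.Probability.LatticeModels
  Literature.Probability.RandomPlanarGeometry Literature.Topology.PlaneTopology

/-! ### Reflection symmetry of the continuum crossing probability -/

section ContReflection

open scoped ComplexConjugate
open Filter Topology

/-- Conjugation transports paths: `JoinedIn (conj '' F) (conj x) (conj y) ↔ JoinedIn F x y`. [folklore] -/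
theorem joinedIn_image_conj_iff {F : Set ℂ} {x y : ℂ} :
    JoinedIn (conj '' F) (conj x) (conj y) ↔ JoinedIn F x y := by
  constructor
  · intro h
    have h' := h.map Complex.continuous_conj
    rwa [Complex.conj_conj, Complex.conj_conj, image_image,
      show (fun z => conj (conj z)) = id from funext Complex.conj_conj, image_id] at h'
  · exact fun h => h.map Complex.continuous_conj

/-- The conjugate of the lattice point set of a colouring is the lattice point set of the
reflected colouring. [folklore] -/
theorem conjSet_image_triEmbed (ω : Set (Site 2)) :
    conjSet (triEmbed '' ω) = triEmbed '' (triConjFun '' ω) := by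
  ext z
  simp only [mem_conjSet, mem_image, exists_exists_and_eq_and, triEmbed_triConjFun]
  constructor
  · rintro ⟨v, hv, h⟩
    exact ⟨v, hv, by rw [h, Complex.conj_conj]⟩
  · rintro ⟨v, hv, rfl⟩
    exact ⟨v, hv, by rw [Complex.conj_conj]⟩

/-- The reflection of `ℤ²` commutes with complements of colourings. [folklore] -/
theorem compl_image_triConjFun (ω : Set (Site 2)) : (triConjFun '' ω)ᶜ = triConjFun '' ωᶜ := by
  have : triConjFun = ⇑triConj := rfl
  rw [this, Set.image_compl_eq triConj.bijective]

/-- The black region is conjugation-equivariant. [folklore] -/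
theorem conj_mem_blackRegion_iff (B W : Set ℂ) (z : ℂ) :
    conj z ∈ blackRegion B W ↔ z ∈ blackRegion (conjSet B) (conjSet W) := by
  rw [mem_blackRegion, mem_blackRegion, infDist_conjSet, infDist_conjSet]

/-- **The continuum crossing event of the conjugate data is the crossing event of the
reflected colouring.** [folklore] -/
theorem voronoiCrossing_conjSet_iff (Ω A B : Set ℂ) (δ : ℝ) (ω : Set (Site 2)) :
    voronoiCrossing (conjSet Ω) (conjSet A) (conjSet B) δ (triEmbed '' ω) (triEmbed '' ωᶜ) ↔
      voronoiCrossing Ω A B δ (triEmbed '' (triConjFun '' ω)) (triEmbed '' (triConjFun '' ω)ᶜ) := by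
  set ω' : Set (Site 2) := triConjFun '' ω with hω'
  set K : Set ℂ := closure Ω ∩ {z | z / (δ : ℂ) ∈ blackRegion (triEmbed '' ω') (triEmbed '' ω'ᶜ)} with hK
  have hωω' : triConjFun '' ω' = ω := by
    rw [hω', image_image]
    simp only [triConjFun_triConjFun, image_id']
  have hB : triEmbed '' ω = conjSet (triEmbed '' ω') := by rw [conjSet_image_triEmbed, hωω']
  have hW : triEmbed '' ωᶜ = conjSet (triEmbed '' ω'ᶜ) := by
    rw [conjSet_image_triEmbed, ← compl_image_triConjFun, hωω']
  have hset : closure (conjSet Ω) ∩ {z | z / (δ : ℂ) ∈ blackRegion (triEmbed '' ω) (triEmbed '' ωᶜ)} =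
      conj '' K := by
    rw [← conjSet_eq_image]
    ext z
    simp only [mem_inter_iff, mem_setOf_eq, mem_conjSet, closure_conjSet, hK]
    rw [hB, hW, ← conj_mem_blackRegion_iff, map_div₀, Complex.conj_ofReal]
  unfold voronoiCrossing
  rw [hset]
  constructor
  · rintro ⟨x, hx, y, hy, hJ⟩
    refine ⟨conj x, hx, conj y, hy, ?_⟩
    rw [← joinedIn_image_conj_iff, Complex.conj_conj, Complex.conj_conj]
    exact hJ
  · rintro ⟨x, hx, y, hy, hJ⟩
    refine ⟨conj x, by simpa using hx, conj y, by simpa using hy, ?_⟩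
    exact joinedIn_image_conj_iff.2 hJ

local notation3 "contProb[" R ", " δ "]" => MeasureTheory.Measure.real (sitePercolation (Site 2) half)
  {ω : Set (Site 2) | voronoiCrossing (JordanDomain.carrier (MarkedDomain.toJordanDomain R))
    (MarkedDomain.arc R 0) (MarkedDomain.arc R 2) δ (triEmbed '' ω) (triEmbed '' ωᶜ)}

/-- **The continuum crossing probability of the conjugate rectangle equals that of the
rectangle** (reflection symmetry of `𝕋` and of `P_{1/2}`, `sitePercolation_real_preimage_relabel`;
analogue of `triDomainCrossingProb_conj`). [folklore] -/
theorem contProb_conj (R : ConformalRectangle) (δ : ℝ) : contProb[R.conjugate, δ] = contProb[R, δ] := by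
  have h1 : (R.conjugate).carrier = conjSet R.carrier := MarkedDomain.conjugate_carrier R
  have hset : {ω : Set (Site 2) | voronoiCrossing (R.conjugate).carrier ((R.conjugate).arc 0)
      ((R.conjugate).arc 2) δ (triEmbed '' ω) (triEmbed '' ωᶜ)} =
      SiteConfig.relabel triConj ⁻¹' {ω : Set (Site 2) | voronoiCrossing R.carrier (R.arc 0) (R.arc 2) δ
        (triEmbed '' ω) (triEmbed '' ωᶜ)} := by
    ext ω
    rw [h1, MarkedDomain.conjugate_arc, MarkedDomain.conjugate_arc, mem_setOf_eq,
      voronoiCrossing_conjSet_iff, mem_preimage, SiteConfig.relabel_apply, mem_setOf_eq]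
    rfl
  rw [hset, sitePercolation_real_preimage_relabel]

end ContReflection

/-! ### From the discrete approximation to Cardy's formula for the continuum event -/

section ContChain

open Filter Topology
open scoped ComplexConjugate

local notation3 "contProb[" R ", " δ "]" => MeasureTheory.Measure.real (sitePercolation (Site 2) half)
  {ω : Set (Site 2) | voronoiCrossing (JordanDomain.carrier (MarkedDomain.toJordanDomain R))
    (MarkedDomain.arc R 0) (MarkedDomain.arc R 2) δ (triEmbed '' ω) (triEmbed '' ωᶜ)}

/-- **(D′) for the continuum event, anticlockwise Carleson data** (copy of
`smirnov_separatingData_of_discreteApprox`, the four discrete facts being theorems of the tree).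
[cite: BollobasRiordan2006, Ch. 7 §7.2.6 pp. 196–203] -/
theorem cont_separatingData_of_anticlockwise (R : ConformalRectangle) (a b c d : ℂ)
    (ψ : ConformalEquiv R.carrier (openTriangle a b c)) (habc : IsEquilateral a b c)
    (hd : d ∈ openSegment ℝ c a) (hψ : IsCarlesonMap R a b c d ψ) (hacw : triangleTurn a b c = triZeta ^ 2) :
    ∃ (Sm Sp : ℝ → Finset ℂ) (fm fp : ℝ → Fin 3 → ℂ → ℝ),
      IsSeparatingData R (triangleTurn a b c) Sm fm ∧ IsSeparatingData R (triangleTurn a b c) Sp fp ∧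
        ∃ (zm zp : ℝ → ℂ) (e : ℝ → ℝ),
          (∀ᶠ δ in 𝓝[>] (0 : ℝ), zm δ ∈ Sm δ ∧ zm δ ∈ R.carrier ∧ zp δ ∈ Sp δ ∧ zp δ ∈ R.carrier) ∧
            Tendsto zm (𝓝[>] 0) (𝓝 (R.pt 3)) ∧ Tendsto zp (𝓝[>] 0) (𝓝 (R.pt 3)) ∧
              Tendsto e (𝓝[>] 0) (𝓝 0) ∧
                ∀ᶠ δ in 𝓝[>] (0 : ℝ), fm δ 1 (zm δ) - e δ ≤ contProb[R, δ] ∧ contProb[R, δ] ≤ fp δ 1 (zp δ) + e δ := by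
  have h13 : tri_discreteCauchy :=
    tri_discreteCauchy_of_subset_arms_of_rotate tri_sepEvent_diff_subset_arms_holds tri_sepDiffProb_rotate_holds
  have h198 : tri_sepProb_sub_le_of_dualPath :=
    tri_sepProb_sub_le_of_dualPath_of_subset_arms tri_sepEvent_diff_subset_arms_holds
  have h200 : tri_sepProb_boundary_tendsto := tri_sepProb_boundary_tendsto_holds
  have h40 : tri_openCrossingProb_approx_sepProb := tri_openCrossingProb_approx_sepProb_holds
  obtain ⟨Gm, Gp, hGm, hGp, e, he, hsand⟩ := cont_exists_discreteApprox R a b c d ψ habc hd hψ hacw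
  obtain ⟨zsm, hzsm, hztm, hfm⟩ := h40 R Gm hGm
  obtain ⟨zsp, hzsp, hztp, hfp⟩ := h40 R Gp hGp
  rw [hacw, ← triOmega_eq]
  refine ⟨_, _, _, _, isSeparatingData_of_discreteApprox h13 h198 h200 hGm,
    isSeparatingData_of_discreteApprox h13 h198 h200 hGp,
    fun δ => (δ : ℂ) * hexCenter (zsm δ), fun δ => (δ : ℂ) * hexCenter (zsp δ),
    fun δ => e δ + |(Gm δ).openCrossingProb 0 2 - (Gm δ).dropLast.sepProb 1 (zsm δ)| +
      |(Gp δ).openCrossingProb 0 2 - (Gp δ).dropLast.sepProb 1 (zsp δ)|, ?_, hztm, hztp, ?_, ?_⟩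
  · filter_upwards [hzsm, hzsp] with δ hm hp
    exact ⟨Finset.mem_image_of_mem _ hm.1, hm.2, Finset.mem_image_of_mem _ hp.1, hp.2⟩
  · have h := (he.add hfm.abs).add hfp.abs
    simpa using h
  · have hpos : ∀ᶠ δ in 𝓝[>] (0 : ℝ), δ ≠ 0 := (eventually_mem_nhdsWithin).mono fun δ hδ => ne_of_gt hδ
    filter_upwards [hsand, hpos] with δ hδ hδ0
    rw [(Gm δ).dropLast.sepProbFun_apply hδ0, (Gp δ).dropLast.sepProbFun_apply hδ0]
    have h2 := le_abs_self ((Gm δ).openCrossingProb 0 2 - (Gm δ).dropLast.sepProb 1 (zsm δ))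
    have h3 := neg_abs_le ((Gm δ).openCrossingProb 0 2 - (Gm δ).dropLast.sepProb 1 (zsm δ))
    have h4 := le_abs_self ((Gp δ).openCrossingProb 0 2 - (Gp δ).dropLast.sepProb 1 (zsp δ))
    have h5 := neg_abs_le ((Gp δ).openCrossingProb 0 2 - (Gp δ).dropLast.sepProb 1 (zsp δ))
    have h6 := abs_nonneg ((Gm δ).openCrossingProb 0 2 - (Gm δ).dropLast.sepProb 1 (zsm δ))
    have h7 := abs_nonneg ((Gp δ).openCrossingProb 0 2 - (Gp δ).dropLast.sepProb 1 (zsp δ))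
    constructor <;> linarith [hδ.1, hδ.2]

/-- **(D′) for the continuum event, all conformal rectangles** (copy of
`smirnov_exists_separatingData_of_anticlockwise` with `contProb_conj`): the clockwise case is the
complex conjugate of the anticlockwise one. [cite: BollobasRiordan2006, Ch. 7 §7.2.2 pp. 168–169, §7.2.6] -/
theorem cont_separatingData (R : ConformalRectangle) (a b c d : ℂ)
    (ψ : ConformalEquiv R.carrier (openTriangle a b c)) (habc : IsEquilateral a b c)
    (hd : d ∈ openSegment ℝ c a) (hψ : IsCarlesonMap R a b c d ψ) :
    ∃ (Sm Sp : ℝ → Finset ℂ) (fm fp : ℝ → Fin 3 → ℂ → ℝ),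
      IsSeparatingData R (triangleTurn a b c) Sm fm ∧ IsSeparatingData R (triangleTurn a b c) Sp fp ∧
        ∃ (zm zp : ℝ → ℂ) (e : ℝ → ℝ),
          (∀ᶠ δ in 𝓝[>] (0 : ℝ), zm δ ∈ Sm δ ∧ zm δ ∈ R.carrier ∧ zp δ ∈ Sp δ ∧ zp δ ∈ R.carrier) ∧
            Tendsto zm (𝓝[>] 0) (𝓝 (R.pt 3)) ∧ Tendsto zp (𝓝[>] 0) (𝓝 (R.pt 3)) ∧
              Tendsto e (𝓝[>] 0) (𝓝 0) ∧
                ∀ᶠ δ in 𝓝[>] (0 : ℝ), fm δ 1 (zm δ) - e δ ≤ contProb[R, δ] ∧ contProb[R, δ] ≤ fp δ 1 (zp δ) + e δ := by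
  rcases triangleTurn_eq_or_of_isEquilateral habc with hacw | hcw
  · exact cont_separatingData_of_anticlockwise R a b c d ψ habc hd hψ hacw
  set R' : ConformalRectangle := R.conjugate with hR'
  set ψ' : ConformalEquiv R'.carrier (openTriangle (starRingEnd ℂ a) (starRingEnd ℂ b) (starRingEnd ℂ c)) :=
    (ψ.conjugate R.isOpen (isOpen_openTriangle a b c)).trans
      (ConformalEquiv.ofEq (conjSet_openTriangle a b c)) with hψ'
  have habc' := habc.conj
  have hd' := mem_openSegment_conj hd
  have hbv : ∀ (i : Fin 4) (w : ℂ), ψ.HasBoundaryValue (R.pt i) w →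
      ψ'.HasBoundaryValue (R'.pt i) (starRingEnd ℂ w) := by
    intro i w hw
    exact ConformalEquiv.HasBoundaryValue.conjugate R.isOpen (isOpen_openTriangle a b c) hw
  have hψ'C : IsCarlesonMap R' (starRingEnd ℂ a) (starRingEnd ℂ b) (starRingEnd ℂ c) (starRingEnd ℂ d) ψ' :=
    ⟨hbv 0 a hψ.1, hbv 1 b hψ.2.1, hbv 2 c hψ.2.2.1, hbv 3 d hψ.2.2.2⟩
  have hacw' : triangleTurn (starRingEnd ℂ a) (starRingEnd ℂ b) (starRingEnd ℂ c) = triZeta ^ 2 := by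
    rw [triangleTurn_conj, hcw, Complex.conj_conj]
  obtain ⟨Sm, Sp, fm, fp, hDm, hDp, zm, zp, e, hmem, hzm, hzp, he, hsand⟩ :=
    cont_separatingData_of_anticlockwise R' _ _ _ _ ψ' habc' hd' hψ'C hacw'
  rw [hacw'] at hDm hDp
  have hω : triangleTurn a b c = starRingEnd ℂ (triZeta ^ 2) := hcw
  rw [hω]
  refine ⟨_, _, _, _, hDm.ofConj, hDp.ofConj, fun δ => starRingEnd ℂ (zm δ), fun δ => starRingEnd ℂ (zp δ), e,
    ?_, ?_, ?_, he, ?_⟩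
  · filter_upwards [hmem] with δ hδ
    obtain ⟨h1, h2, h3, h4⟩ := hδ
    refine ⟨Finset.mem_image_of_mem _ h1, ?_, Finset.mem_image_of_mem _ h3, ?_⟩
    · rw [hR', MarkedDomain.conjugate_carrier, mem_conjSet] at h2; exact h2
    · rw [hR', MarkedDomain.conjugate_carrier, mem_conjSet] at h4; exact h4
  · have := (Complex.continuous_conj.tendsto _).comp hzm
    rw [hR', MarkedDomain.conjugate_pt, Complex.conj_conj] at this
    exact this
  · have := (Complex.continuous_conj.tendsto _).comp hzp
    rw [hR', MarkedDomain.conjugate_pt, Complex.conj_conj] at this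
    exact this
  · filter_upwards [hsand] with δ hδ
    rw [hR', contProb_conj] at hδ
    simpa using hδ

/-- **(D) for the continuum event**: Smirnov separating families with the sandwich for the
continuum crossing probability (copy of `smirnov_exists_separatingFamilies_of_separatingData`).
[cite: BollobasRiordan2006, Ch. 7 §7.2.6 pp. 196–203] -/
theorem cont_separatingFamilies (R : ConformalRectangle) (a b c d : ℂ)
    (ψ : ConformalEquiv R.carrier (openTriangle a b c)) (habc : IsEquilateral a b c)
    (hd : d ∈ openSegment ℝ c a) (hψ : IsCarlesonMap R a b c d ψ) :
    ∃ δ₀ > (0 : ℝ), ∃ gm gp : ℝ → Fin 3 → ℂ → ℝ,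
      IsSmirnovFamily R a b c δ₀ gm ∧ IsSmirnovFamily R a b c δ₀ gp ∧
        ∃ (zm zp : ℝ → ℂ) (e : ℝ → ℝ), (∀ δ ∈ Ioo 0 δ₀, zm δ ∈ R.carrier ∧ zp δ ∈ R.carrier) ∧
          Tendsto zm (𝓝[>] 0) (𝓝 (R.pt 3)) ∧ Tendsto zp (𝓝[>] 0) (𝓝 (R.pt 3)) ∧
            Tendsto e (𝓝[>] 0) (𝓝 0) ∧
              ∀ δ ∈ Ioo 0 δ₀, gm δ 1 (zm δ) - e δ ≤ contProb[R, δ] ∧ contProb[R, δ] ≤ gp δ 1 (zp δ) + e δ := by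
  obtain ⟨Sm, Sp, fm, fp, hDm, hDp, zm, zp, e, hmem, hzm, hzp, he, hsand⟩ :=
    cont_separatingData R a b c d ψ habc hd hψ
  obtain ⟨εm, hεm, hdensem⟩ := hDm.dense
  obtain ⟨εp, hεp, hdensep⟩ := hDp.dense
  set gm : ℝ → Fin 3 → ℂ → ℝ := dataFamily Sm fm εm with hgm
  set gp : ℝ → Fin 3 → ℂ → ℝ := dataFamily Sp fp εp with hgp
  obtain ⟨δ₀, hδ₀, hgood⟩ := exists_forall_Ioo_of_eventually (hmem.and hsand)
  set e' : ℝ → ℝ := fun δ => e δ + (gm δ 1 (zm δ) - fm δ 1 (zm δ)) with he'_def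
  have hdiff : Tendsto (fun δ => gm δ 1 (zm δ) - fm δ 1 (zm δ)) (𝓝[>] 0) (𝓝 0) := by
    rw [Metric.tendsto_nhdsWithin_nhds]
    intro η hη
    obtain ⟨δ₁, hδ₁, h₁⟩ := exists_forall_Ioo_of_eventually
      ((dataFamily_approx hDm hεm (half_pos hη)).and hmem)
    refine ⟨δ₁, hδ₁, fun {δ} hδpos hδd => ?_⟩
    have hδ : δ ∈ Ioo 0 δ₁ := by
      refine ⟨hδpos, ?_⟩
      rw [Real.dist_eq, sub_zero, abs_of_pos (mem_Ioi.1 hδpos)] at hδd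
      exact hδd
    obtain ⟨happ, hm⟩ := h₁ δ hδ
    have h := happ 1 (zm δ) hm.1
    rw [Real.dist_0_eq_abs, abs_lt]
    constructor <;> simp only [hgm] <;> linarith [h.1, h.2]
  have he' : Tendsto e' (𝓝[>] 0) (𝓝 0) := by
    simpa using he.add hdiff
  refine ⟨δ₀, hδ₀, gm, gp, hDm.isSmirnovFamily hεm hdensem δ₀, hDp.isSmirnovFamily hεp hdensep δ₀,
    zm, zp, e', fun δ hδ => ⟨(hgood δ hδ).1.2.1, (hgood δ hδ).1.2.2.2⟩, hzm, hzp, he', fun δ hδ => ?_⟩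
  obtain ⟨⟨hzm₁, -, hzp₁, -⟩, hlow, hup⟩ := hgood δ hδ
  constructor
  · simp only [he'_def]
    linarith
  · have h1 : fp δ 1 (zp δ) ≤ gp δ 1 (zp δ) := mcShane.le_self hzp₁
    have h2 : fm δ 1 (zm δ) ≤ gm δ 1 (zm δ) := mcShane.le_self hzm₁
    simp only [he'_def]
    linarith

/-- **Smirnov's theorem in Carleson's form for the continuum event**: for a conformal rectangle
with a Carleson datum `(a, b, c, d, ψ)`, the `P_{1/2}`-probability of the continuum crossing of
`closure Ω` by the closed hexagons of the open sites tends to Carleson's ratio `|d - c|/|a - c|`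
(Bollobás–Riordan 2006, Ch. 7, Thm. 2 as proved on pp. 202–203, the boundary treatment being
immaterial by the remark p. 195). [cite: BollobasRiordan2006, Ch. 7 Thm. 2 (proof pp. 202–203), remark p. 195] -/
theorem tendsto_contProb_carlesonRatio (R : ConformalRectangle) (a b c d : ℂ)
    (ψ : ConformalEquiv R.carrier (openTriangle a b c)) (habc : IsEquilateral a b c)
    (hd : d ∈ openSegment ℝ c a) (hψ : IsCarlesonMap R a b c d ψ) :
    Tendsto (fun δ => contProb[R, δ]) (𝓝[>] 0) (𝓝 (carlesonRatio a c d)) := by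
  obtain ⟨δ₀, hδ₀, gm, gp, hgm, hgp, zm, zp, e, hzmem, hzm, hzp, he, hsand⟩ :=
    cont_separatingFamilies R a b c d ψ habc hd hψ
  have hM := triangleIntegral_eq_zero_of_forall_lattice_holds
  have hU := smirnov_claim24_holds
  have h1 := hgm.tendsto_apply_one hM hU hδ₀ habc hd hψ (fun δ hδ => (hzmem δ hδ).1) hzm
  have h2 := hgp.tendsto_apply_one hM hU hδ₀ habc hd hψ (fun δ hδ => (hzmem δ hδ).2) hzp
  have hev : ∀ᶠ δ in 𝓝[>] (0 : ℝ), δ ∈ Ioo 0 δ₀ := Ioo_mem_nhdsGT hδ₀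
  have hlow : Tendsto (fun δ => gm δ 1 (zm δ) - e δ) (𝓝[>] 0) (𝓝 (carlesonRatio a c d)) := by
    simpa using h1.sub he
  have hup : Tendsto (fun δ => gp δ 1 (zp δ) + e δ) (𝓝[>] 0) (𝓝 (carlesonRatio a c d)) := by
    simpa using h2.add he
  exact tendsto_of_tendsto_of_tendsto_of_le_of_le' hlow hup (hev.mono fun δ hδ => (hsand δ hδ).1)
    (hev.mono fun δ hδ => (hsand δ hδ).2)

/-- **Cardy's formula for the continuum hexagon crossing of Smirnov's model.** For every
conformal rectangle `(Ω; a, b, c, d)`, the `P_{1/2}`-probability that the closed hexagons of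
`δ𝕋` of the open sites of fair site percolation on `𝕋` contain a continuum path inside
`closure Ω` from the arc `(ab)` to the arc `(cd)` converges, as `δ → 0⁺`, to Cardy's function of
the cross-ratio of any uniformizing datum — Smirnov's theorem (in tree for G02's discretisation,
`hasCrossingLimit_triDomainCrossingProb_holds`) in the continuum-path formulation of
Benjamini–Schramm (1998) §1 / Bollobás–Riordan (2006) Ch. 8 §8.2, through (B), (C), (M), (U) of
the tree and the continuum sandwich. [cite: BollobasRiordan2006, Ch. 7 Thm. 2 p. 165 and remark p. 195] [cite: Smirnov2001, Thm. 1] -/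
theorem hasCrossingLimit_contProb (R : ConformalRectangle) :
    R.HasCrossingLimit (fun δ => contProb[R, δ]) Literature.Probability.RandomPlanarGeometry.cardyFunction := by
  intro φ x hφ
  obtain ⟨a, b, c, d, ψ, habc, hd, hψ⟩ := exists_isCarlesonMap_holds R
  rw [cardyFunction_crossRatio_eq_carlesonRatio_holds R a b c d ψ φ x habc hd hψ hφ]
  exact tendsto_contProb_carlesonRatio R a b c d ψ habc hd hψ

/-- **`JitteredTriangularLeg` holds at `σ = 0`.** The `σ = 0` instance of the conclusion of the
route item stmt-CriticalPhenomena-6436 (Cardy's formula for the annealed Voronoi percolation of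
the jittered triangular lattice `𝕋 + σ N(0,1)²` with fair colours, continuum-closure event):
at `σ = 0` the nuclei are the sites of `𝕋` and the statement is Cardy's formula for the
continuum hexagon crossing, `hasCrossingLimit_contProb`, through `hasCrossingLimit_jitteredLeg_zero_iff`.
(The item for `σ > 0` is an instance of crossing universality and is open.) [cite: BollobasRiordan2006, Ch. 7 Thm. 2 p. 165] -/
theorem jitteredTriangularLeg_sigma_zero (R : ConformalRectangle) :
    R.HasCrossingLimit (fun δ ↦ ((Measure.infinitePi (fun _ : Site 2 ↦
        (ProbabilityTheory.gaussianReal 0 1).prod (ProbabilityTheory.gaussianReal 0 1))).prod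
          (sitePercolation (Site 2) half)).real
        {p | ∃ x ∈ R.arc 0, ∃ y ∈ R.arc 2, JoinedIn (closure R.carrier ∩
          {z | infDist (z / (δ : ℂ)) ((fun v ↦ triEmbed v + ((0 : ℝ) : ℂ) * ((p.1 v).1 + (p.1 v).2 * Complex.I)) '' p.2) ≤
            infDist (z / (δ : ℂ)) ((fun v ↦ triEmbed v + ((0 : ℝ) : ℂ) * ((p.1 v).1 + (p.1 v).2 * Complex.I)) '' (p.2)ᶜ)}) x y})
        Literature.Probability.RandomPlanarGeometry.cardyFunction :=
  (hasCrossingLimit_jitteredLeg_zero_iff R).2 (hasCrossingLimit_contProb R)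

end ContChain

end Summit.CriticalPhenomena.CardyFormulaZ2.Theorems

end
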